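import Summits.HodgeConjecture.HodgeConjecture.Theorems.K2E3CongruenceLayerCharacterSurjectiveGL   -- ★ p855619 (this seat): (S) `exists_valBound_and_forall_eq_map_trace` (Circle-valued layer characters are `χ_X`); brings ★ p855410 layers, ★ `congruenceGL`
import Summits.HodgeConjecture.HodgeConjecture.Theorems.K2E3CongruenceLayerCharactersGL            -- ★ p855532 (this seat): (H-char) `map_trace_mul_coe_sub_one_eq_one` (deep-level triviality)
import HarnessLib

/-!
# Crux `H413` — K2-LIT E3 «EllipticInputs», U12-h engine: ADAPTERS for the depth-halving assembly — (1) the `K_γ`-CONTRACTION of conjugation in `ValBound` form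
# (`‖Ad(k)X − X‖ ≤ |γ|·‖X‖`, the `δ`-smallness input «`A = Ad(k) − 1`» of ★ L6), (2) the DEPTH LOWER BOUND (a character of `K_m` non-trivial on `K_δ` has a parameter with an
# entry of valuation `> |ϖ|... ` beyond the level), (3) the `ℂ`-valued reading of (S): a function `χ : GL_n(F) → ℂ` multiplicative on `K_{N'}`, trivial on `K_N`, of modulus `1`
# on `K_{N'}`, is `k ↦ ψ(tr(X(k − 1)))` with `v(X) ≤ |ϖ|^{−N}`

Cell `hodgecm-mathlib`, Track B «K2-LIT», crux item `stmt-HodgeConjecture-24833` (h413), line `K2_E3_EllipticInputs`, unit U12 «HC characters», socket U12-h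
`sig_K2E3CharLocConstNearRegular` (‹#9L›), depth-halving road (memo v4 `K2/K2E3-p09/g2/MEMO-U12h-HF-bricks.v4.K2E3-p09-g2.md`): adapters asked for by the 9L line lead K2E3-p09 (g2)
(K2 bus 2026-09-03T23:30:48Z «GO your default `K2E3CongruenceLayerAdapters`») so that (Cl)∕(It) dock by `exact`; seat K2E1b-p08 (g2); `--supports stmt-HodgeConjecture-24833 --as helper`.
THEOREMS ONLY — no `def`, no named fact, no instance, no notation, no `sorry`.  §1–§2 GENERIC (`ValuativeRel` field); §3 in the local-field setting of ★ (S) (`IsNonarchimedeanLocalField F`,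
`ψ : AddChar F Circle` of conductor exactly `𝒪`).  HONEST LABEL: HC_CM is proved only modulo the 7 printed citations (2 remaining named inputs: hLiu418 = stmt-HodgeConjecture-24832,
h413 = stmt-HodgeConjecture-24833) until rung 0 closes; count-neutral.

THE MATHEMATICS [HarishChandra1999, §19 (2) p. 81 and Lemma 19.4; Howe1977Kirillov, §1; BushnellHenniart2006, §1.1].
* §1 **`k ∈ K_γ`, `v(X) ≤ ξ` ⇒ `v(kXk⁻¹ − X) ≤ ξγ` and `v(k⁻¹Xk − X) ≤ ξγ`** (`kXk⁻¹ − X = ((k−1)X − X(k−1))·k⁻¹`): HC's hypothesis (2) p. 81 «`|(Ad(exp λ) − 1)X| ≤ |λ||X|`» for the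
  congruence subgroups — the `δ = |γ|` of ★ L6 `mul_norm_proj_le_of_eq_add` ∕ `norm_sub_le_of_sub_eq_add`; and the orbit reading `v(X₂ − X₁) ≤ max(ξγ, η)` for
  `X₂ = k⁻¹X₁k + E`, `v(E) ≤ η`.
* §2 **depth lower bound**: if `χ_X` (with `ψ` trivial on `𝒪`) is NOT trivial on `K_δ` then `v(X) ≰ δ⁻¹`, i.e. some entry has `v(X_{ij}) > δ⁻¹` (contrapositive of ★ (H-char)
  `map_trace_mul_coe_sub_one_eq_one`) — «depth `N` ⇒ `|X| > q^{N−1}`» for the minimal level.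
* §3 **(S) for `ℂ`-valued characters**: `χ : GL_n(F) → ℂ` multiplicative on `K_{N'}`, `≡ 1` on `K_N` (`1 ≤ N' ≤ N ≤ 2N'`), `‖χ k‖ = 1` on `K_{N'}` ⇒ `∃ X`, `v(X) ≤ |ϖ|^{−N}`,
  `χ k = ψ(tr(X(k−1)))` (in `ℂ`) on `K_{N'}` — lift `χ` to `Circle` (Mathlib `Submonoid.unitSphere`) and apply ★ (S) `exists_valBound_and_forall_eq_map_trace`.  (The eigencharacters
  of the finite layer acting on a `ℂ`-representation have modulus `1`, which is how (Cl) delivers them.)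

## References
* [HarishChandra1999] Harish-Chandra (DeBacker–Sally), *Admissible Invariant Distributions on Reductive p-adic Groups*, ULECT 16 (1999), §19 p. 81 (2), Lemma 19.4.
* [Howe1977Kirillov] R. Howe, *Kirillov theory for compact p-adic groups*, Pacific J. Math. 73 (1977), 365–381, §1.
* [BushnellHenniart2006] C. J. Bushnell, G. Henniart, *The Local Langlands Conjecture for GL(2)*, Grundlehren 335 (2006), §1.1, §1.7.
-/

set_option autoImplicit false
-- the mandated namespace repeats `HodgeConjecture.HodgeConjecture`, as in every `Theorems/*.lean` of this sub-problem
set_option linter.dupNamespace false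

noncomputable section

open scoped MatrixGroups
open Matrix ValuativeRel Literature.NumberTheory.Automorphic

namespace Summit.HodgeConjecture.HodgeConjecture.Cruxes.H413.K2E3CongruenceLayerAdapters

/-! ## §1 The `K_γ`-contraction of conjugation (`ValBound` form of `|(Ad k − 1)X| ≤ |γ||X|`) -/

section Contraction

variable {F : Type*} [Field F] [ValuativeRel F] {n : ℕ}

omit [ValuativeRel F] in
/-- `kXk⁻¹ − X = ((k − 1)X − X(k − 1))·k⁻¹` in `M_n(F)`. [folklore] -/
theorem coe_mul_mul_coe_inv_sub_eq (k : GL (Fin n) F) (X : Matrix (Fin n) (Fin n) F) :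
    (k : Matrix (Fin n) (Fin n) F) * X * ((k⁻¹ : GL (Fin n) F) : Matrix (Fin n) (Fin n) F) - X =
      (((k : Matrix (Fin n) (Fin n) F) - 1) * X - X * ((k : Matrix (Fin n) (Fin n) F) - 1)) * ((k⁻¹ : GL (Fin n) F) : Matrix (Fin n) (Fin n) F) := by
  have hk : (k : Matrix (Fin n) (Fin n) F) * ((k⁻¹ : GL (Fin n) F) : Matrix (Fin n) (Fin n) F) = 1 := by rw [← Units.val_mul, mul_inv_cancel, Units.val_one]
  rw [show ((k : Matrix (Fin n) (Fin n) F) - 1) * X - X * ((k : Matrix (Fin n) (Fin n) F) - 1) = (k : Matrix (Fin n) (Fin n) F) * X - X * (k : Matrix (Fin n) (Fin n) F) by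
      noncomm_ring,
    Matrix.sub_mul, Matrix.mul_assoc X, hk, Matrix.mul_one]

/-- **`k ∈ K_γ`, `v(X) ≤ ξ` ⇒ `v(kXk⁻¹ − X) ≤ ξ·γ`** — the congruence subgroup `K_γ` moves every matrix by at most the factor `γ` (HC1999 p. 81 (2) «`|(Ad(exp λ) − 1)X| ≤ |λ||X|`»; the
`δ`-smallness of `A = Ad(k) − 1` in ★ L6). [cite: HarishChandra1999, §19 p. 81 (2)] [cite: Howe1977Kirillov, §1] -/
theorem valBound_conj_sub_self {γ ξ : ValueGroupWithZero F} {k : GL (Fin n) F} (hk : k ∈ congruenceGL n γ) {X : Matrix (Fin n) (Fin n) F} (hX : ValBound ξ X) :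
    ValBound (ξ * γ) ((k : Matrix (Fin n) (Fin n) F) * X * ((k⁻¹ : GL (Fin n) F) : Matrix (Fin n) (Fin n) F) - X) := by
  rw [coe_mul_mul_coe_inv_sub_eq]
  have h1 : ValBound (ξ * γ) (((k : Matrix (Fin n) (Fin n) F) - 1) * X) := by
    have h := hk.2.1.mul hX; rwa [mul_comm γ ξ] at h
  have h := (h1.sub (hX.mul hk.2.1)).mul hk.1.2
  rwa [mul_one] at h

/-- The same for `k⁻¹Xk − X` (apply the previous lemma to `k⁻¹ ∈ K_γ`). [cite: HarishChandra1999, §19 p. 81 (2)] -/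
theorem valBound_inv_conj_sub_self {γ ξ : ValueGroupWithZero F} {k : GL (Fin n) F} (hk : k ∈ congruenceGL n γ) {X : Matrix (Fin n) (Fin n) F} (hX : ValBound ξ X) :
    ValBound (ξ * γ) (((k⁻¹ : GL (Fin n) F) : Matrix (Fin n) (Fin n) F) * X * (k : Matrix (Fin n) (Fin n) F) - X) := by
  have h := valBound_conj_sub_self (Subgroup.inv_mem _ hk) hX
  rwa [inv_inv] at h

/-- **Orbit reading**: if `X₂ = k⁻¹X₁k + E` with `k ∈ K_γ`, `v(X₁) ≤ ξ`, `v(E) ≤ η`, then `v(X₂ − X₁) ≤ max(ξγ, η)` — all constituents of one `K_γ`-orbit of layer parameters are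
`max(ξγ, η)`-close (HC1999 Lemma 19.4, second inequality, in valuation form). [cite: HarishChandra1999, Lemma 19.4 p. 83] -/
theorem valBound_sub_of_eq_inv_conj_add {γ ξ η : ValueGroupWithZero F} {k : GL (Fin n) F} (hk : k ∈ congruenceGL n γ) {X₁ X₂ E : Matrix (Fin n) (Fin n) F}
    (hX₁ : ValBound ξ X₁) (hE : ValBound η E) (h : X₂ = ((k⁻¹ : GL (Fin n) F) : Matrix (Fin n) (Fin n) F) * X₁ * (k : Matrix (Fin n) (Fin n) F) + E) :
    ValBound (max (ξ * γ) η) (X₂ - X₁) := by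
  have e : X₂ - X₁ = (((k⁻¹ : GL (Fin n) F) : Matrix (Fin n) (Fin n) F) * X₁ * (k : Matrix (Fin n) (Fin n) F) - X₁) + E := by rw [h]; abel
  rw [e]
  exact ((valBound_inv_conj_sub_self hk hX₁).mono (le_max_left _ _)).add (hE.mono (le_max_right _ _))

/-- Conjugation by `GL_n(𝒪)` preserves valuation bounds: `κ ∈ GL_n(𝒪)`, `v(X) ≤ ξ` ⇒ `v(κXκ⁻¹) ≤ ξ` (orbit points have the same size). [cite: HarishChandra1999, Cor. 19.5 p. 83] -/
theorem valBound_coe_mul_mul_coe_inv {ξ : ValueGroupWithZero F} {κ : GL (Fin n) F} (hκ : κ ∈ glInt n F) {X : Matrix (Fin n) (Fin n) F} (hX : ValBound ξ X) :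
    ValBound ξ ((κ : Matrix (Fin n) (Fin n) F) * X * ((κ⁻¹ : GL (Fin n) F) : Matrix (Fin n) (Fin n) F)) := by
  have h := ((valBound_one_of_mem_glInt hκ).mul hX).mul (valBound_one_of_mem_glInt (Subgroup.inv_mem _ hκ))
  rwa [one_mul, mul_one] at h

end Contraction

/-! ## §2 The depth lower bound: a character non-trivial on `K_δ` has a parameter beyond `δ⁻¹` -/

section Depth

variable {F : Type*} [Field F] [ValuativeRel F] {n : ℕ} {M : Type*} [CommMonoid M] (ψ : AddChar F M)

/-- **DEPTH LOWER BOUND**: if `ψ` is trivial on `𝒪` and `χ_X(k) ≠ 1` for some `k ∈ K_δ`, then `v(X) ≰ ξ` for every `ξ` with `ξδ ≤ 1` — some entry of `X` has valuation `> ξ`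
(contrapositive of ★ (H-char) `map_trace_mul_coe_sub_one_eq_one`).  With `δ = |ϖ|^{N−1}`, `ξ = |ϖ|^{−(N−1)}`: a type of depth exactly `N` has a LARGE parameter on its minimal level.
[cite: HarishChandra1999, §19 Lemma 19.3 p. 82] [cite: Howe1977Kirillov, §1] -/
theorem exists_lt_valuation_apply_of_map_trace_ne_one (hψ : ∀ x : F, valuation F x ≤ 1 → ψ x = 1) {ξ δ : ValueGroupWithZero F} (hξ : ξ * δ ≤ 1)
    {X : Matrix (Fin n) (Fin n) F} {k : GL (Fin n) F} (hk : k ∈ congruenceGL n δ) (hne : ψ (Matrix.trace (X * ((k : Matrix (Fin n) (Fin n) F) - 1))) ≠ 1) :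
    ∃ i j : Fin n, ξ < valuation F (X i j) := by
  by_contra h
  simp only [not_exists, not_lt] at h
  exact hne (K2E3CongruenceLayerCharactersGL.map_trace_mul_coe_sub_one_eq_one ψ hψ hξ (fun i j => h i j) hk)

/-- `ValBound` reading of the same: `¬ ValBound ξ X`. [cite: HarishChandra1999, §19 Lemma 19.3 p. 82] -/
theorem not_valBound_of_map_trace_ne_one (hψ : ∀ x : F, valuation F x ≤ 1 → ψ x = 1) {ξ δ : ValueGroupWithZero F} (hξ : ξ * δ ≤ 1)
    {X : Matrix (Fin n) (Fin n) F} {k : GL (Fin n) F} (hk : k ∈ congruenceGL n δ) (hne : ψ (Matrix.trace (X * ((k : Matrix (Fin n) (Fin n) F) - 1))) ≠ 1) :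
    ¬ ValBound ξ X := fun hX =>
  hne (K2E3CongruenceLayerCharactersGL.map_trace_mul_coe_sub_one_eq_one ψ hψ hξ hX hk)

end Depth

/-! ## §3 (S) for `ℂ`-valued characters of modulus one -/

section ComplexValued

variable {F : Type*} [Field F] [ValuativeRel F] [TopologicalSpace F] [IsNonarchimedeanLocalField F] {n : ℕ} {ϖ : F} {ψ : AddChar F Circle}

/-- **(S), `ℂ`-VALUED READING**: `χ : GL_n(F) → ℂ` multiplicative on `K_{N'}`, trivial on `K_N` (`1 ≤ N' ≤ N ≤ 2N'`) and of modulus `1` on `K_{N'}` is `k ↦ ψ(tr(X(k − 1)))` (as a complex number) for some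
`X` with `v(X) ≤ |ϖ|^{−N}` (`ψ : AddChar F Circle` of conductor exactly `𝒪`) — lift to the unit circle and apply ★ (S) `exists_valBound_and_forall_eq_map_trace`.  This is the form in
which the eigencharacters of a finite congruence layer acting on a complex representation arrive from (Cl). [cite: Howe1977Kirillov, §1] [cite: BushnellHenniart2006, §1.7 Proposition] -/
theorem exists_valBound_and_forall_eq_coe_map_trace (hϖ : IsUniformizingElement ϖ) (hψ : ∀ x : F, valuation F x ≤ 1 → ψ x = 1)
    (hψ' : ∃ x : F, valuation F x ≤ (valuation F ϖ)⁻¹ ∧ ψ x ≠ 1) {N' N : ℕ} (hN' : 1 ≤ N') (hle : N' ≤ N) (h2 : N ≤ 2 * N')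
    (χ : GL (Fin n) F → ℂ)
    (hmul : ∀ k ∈ congruenceGL n (valuation F ϖ ^ N'), ∀ k' ∈ congruenceGL n (valuation F ϖ ^ N'), χ (k * k') = χ k * χ k')
    (htriv : ∀ k ∈ congruenceGL n (valuation F ϖ ^ N), χ k = 1)
    (hnorm : ∀ k ∈ congruenceGL n (valuation F ϖ ^ N'), ‖χ k‖ = 1) :
    ∃ X : Matrix (Fin n) (Fin n) F, ValBound (valuation F ϖ ^ N)⁻¹ X ∧
      ∀ k ∈ congruenceGL n (valuation F ϖ ^ N'), χ k = ((ψ (Matrix.trace (X * ((k : Matrix (Fin n) (Fin n) F) - 1))) : Circle) : ℂ) := by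
  classical
  -- lift `χ` to the circle on `K_{N'}` (value `1` elsewhere)
  let χ' : GL (Fin n) F → Circle := fun k =>
    if h : k ∈ congruenceGL n (valuation F ϖ ^ N') then ⟨χ k, mem_sphere_zero_iff_norm.2 (hnorm k h)⟩ else 1
  have hχ' : ∀ k ∈ congruenceGL n (valuation F ϖ ^ N'), ((χ' k : Circle) : ℂ) = χ k := fun k hk => by
    simp only [χ', dif_pos hk]
  have hK : congruenceGL n (valuation F ϖ ^ N) ≤ congruenceGL n (valuation F ϖ ^ N') :=
    congruenceGL_mono (pow_le_pow_right_of_le_one' hϖ.valuation_le_one hle)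
  have hmul' : ∀ k ∈ congruenceGL n (valuation F ϖ ^ N'), ∀ k' ∈ congruenceGL n (valuation F ϖ ^ N'), χ' (k * k') = χ' k * χ' k' := fun k hk k' hk' =>
    Circle.ext (by rw [Circle.coe_mul, hχ' k hk, hχ' k' hk', hχ' _ (Subgroup.mul_mem _ hk hk'), hmul k hk k' hk'])
  have htriv' : ∀ k ∈ congruenceGL n (valuation F ϖ ^ N), χ' k = 1 := fun k hk =>
    Circle.ext (by rw [hχ' k (hK hk), Circle.coe_one, htriv k hk])
  obtain ⟨X, hX, hXχ⟩ := K2E3CongruenceLayerCharacterSurjectiveGL.exists_valBound_and_forall_eq_map_trace hϖ hψ hψ' hN' hle h2 χ' hmul' htriv'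
  exact ⟨X, hX, fun k hk => by rw [← hχ' k hk, hXχ k hk]⟩

end ComplexValued

end Summit.HodgeConjecture.HodgeConjecture.Cruxes.H413.K2E3CongruenceLayerAdapters

end
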